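import Summits.SmoothPoincare4.SmoothPoincare4.Theorems.ConvexBisectionAcyclicBisectionExistsHgapCharTubeChart
import Summits.SmoothPoincare4.SmoothPoincare4.Theorems.ConvexBisectionAcyclicBisectionExistsHgapCharTubeCore
import Summits.SmoothPoincare4.SmoothPoincare4.Theorems.ConvexBisectionAcyclicBisectionExistsHgapCharFlip
import Summits.SmoothPoincare4.SmoothPoincare4.Theorems.ConvexBisectionAcyclicBisectionExistsHgapCharacterSign
import HarnessLib

/-!
# Hgap ▸ part B, transfer step (R6c), tube side IV: the orientation character of the tube-side map
# `η̂ = f♭ ∘ flip` is `-ε`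
(wave 7, crux stmt-SmoothPoincare4-10508, line `modp-braid-orbits`, stub `stub_T3_dualPresentation` (T3)
▸ HB = `helper_Hgap_twisting` ▸ (R6c); registered sub-goal `helper_beltChar_tube`)

H1's tube-side map (`work/stubs/H1H2H3_interface.lean`; G2-REPORT §4 (R6b)) at a point `p = (m₀, m₁, φ)` of the
three-dimensional belt-tube chart is the ATTACHING tube at core angle `dir m` and fibre vector `‖m‖ e^{2πiφ}`:

  `η♯ (p) = ((f♭ (circlePt (arg (toC (L p)) / 2π), ‖L p‖ • circlePt (p 2))).1).1 ∈ ℝ⁴`,  `f♭ = f.boundaryTube`,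

and its character is `χ_η (p) = det4 (∇rho (η♯ p), ∂₀η♯, ∂₁η♯, ∂₂η♯)` (`∂ₖ = mfderiv 𝓘 𝓘 η♯ p (single k 1)`).
This file proves (R6c): **`sign χ_η = -ε`** near the core, `ε` the frame sign of the transition matrix
`A = CircleTube.fibreDeriv f♭ Φ` against Z4's page tube `Φ` (`0 < ε · frameSign f♭ Φ x` for all `x`):

* §1 the character `χ_F (q) = det4 (∇rho (F q), ∂₀F, ∂₁F, ∂₂F)` of the attaching-tube chart
  `F (q) = ((f♭ (circlePt (q 2), L q)).1).1` (`…HgapCharTubeChart.lean`) is continuous on the chart domain, so its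
  sign at the core (`= sign det A = ε`, `…HgapCharTubeCore.lean`) persists nearby (`attachChar_pos_near_core`);
* §2 `η♯ = F ∘ flip` on the nose (`tubeChart_eq_comp_polarFlip`), hence `χ_η (p) = -χ_F (flip p)`
  (`…HgapCharFlip.lean`, `det D(flip) = -1`), and `flip p` is at distance `‖L p‖` from the core point
  `(0, 0, arg (toC (L p)) / 2π)`;
* §3 **`0 < -ε · χ_η (p)`** for every direction `u` off the closed negative real axis and all `p` with
  `L p = ρ u`, `0 < ρ < δ(u)` (`tubeChar_neg_frameSign`), in particular along the positive `e₀`-ray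
  (`helper_beltChar_tube`, the form consumed by H3's assembly: `L p = ‖L p‖ • planeE0`).

Everything is proved; no named facts, no `sorry`.  References: A. A. Kosinski, *Differential Manifolds* (1993),
VI §6 (6.1) [Kosinski1993]; R. İ. Baykur, AGT 6 (2006), §2.3 [Baykur2006].
-/

noncomputable section

set_option linter.dupNamespace false

open scoped Manifold ContDiff Topology RealInnerProductSpace
open Set Function Metric Filter Complex

namespace Summit.SmoothPoincare4.SmoothPoincare4.Theorems.AcyclicBisectionExists.ModpBraidOrbits

open Literature.Topology.FourManifolds Literature.Topology.FourManifolds.LefschetzBase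
  Literature.Topology.FourManifolds.HandleAttachingMap Literature.Geometry.Symplectic

variable {g : ℕ}

/-! ## §1 Continuity of the character of the attaching-tube chart; its sign near the core -/

section Near

variable (f : HandleAttachingMap 3 2 (Base g)) {L : EuclideanSpace ℝ (Fin 3) →L[ℝ] EuclideanSpace ℝ (Fin 2)}

/-- `det4` is continuous as a function of its four arguments. [folklore] -/
theorem continuous_det4_uncurried : Continuous fun v : EuclideanSpace ℝ (Fin 4) × EuclideanSpace ℝ (Fin 4) ×
    EuclideanSpace ℝ (Fin 4) × EuclideanSpace ℝ (Fin 4) => det4 v.1 v.2.1 v.2.2.1 v.2.2.2 :=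
  continuous_det4_family continuous_fst (continuous_fst.comp continuous_snd)
    (continuous_fst.comp (continuous_snd.comp continuous_snd)) (continuous_snd.comp (continuous_snd.comp continuous_snd))

/-- **The `det4`-character of a `C^∞` map `F : ℝ³ → ℝ⁴` is continuous** on an open set of smoothness:
`q ↦ det4 (∇rho (F q), ∂₀F (q), ∂₁F (q), ∂₂F (q))` (`q ↦ fderiv F q` is continuous there). [folklore] -/
theorem continuousAt_det4_char {F : EuclideanSpace ℝ (Fin 3) → EuclideanSpace ℝ (Fin 4)} {U : Set (EuclideanSpace ℝ (Fin 3))}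
    (hU : IsOpen U) (hF : ContDiffOn ℝ ∞ F U) {q₀ : EuclideanSpace ℝ (Fin 3)} (hq₀ : q₀ ∈ U) :
    ContinuousAt (fun q : EuclideanSpace ℝ (Fin 3) => det4 (gradient (rho g) (F q))
      (fderiv ℝ F q (EuclideanSpace.single (0 : Fin 3) (1 : ℝ))) (fderiv ℝ F q (EuclideanSpace.single (1 : Fin 3) (1 : ℝ)))
      (fderiv ℝ F q (EuclideanSpace.single (2 : Fin 3) (1 : ℝ)))) q₀ := by
  have hq₀U : U ∈ 𝓝 q₀ := hU.mem_nhds hq₀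
  have hD : ContinuousAt (fun q => fderiv ℝ F q) q₀ :=
    (hF.continuousOn_fderiv_of_isOpen hU (by simp)).continuousAt hq₀U
  have hDk : ∀ v : EuclideanSpace ℝ (Fin 3), ContinuousAt (fun q => fderiv ℝ F q v) q₀ := fun v =>
    hD.clm_apply continuousAt_const
  have hF0 : ContinuousAt F q₀ := (hF.continuousOn.continuousWithinAt hq₀).continuousAt hq₀U
  have hN : ContinuousAt (fun q => gradient (rho g) (F q)) q₀ := continuous_gradient_rho.continuousAt.comp hF0
  have hvec := hN.prodMk ((hDk (EuclideanSpace.single (0 : Fin 3) (1 : ℝ))).prodMk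
    ((hDk (EuclideanSpace.single (1 : Fin 3) (1 : ℝ))).prodMk (hDk (EuclideanSpace.single (2 : Fin 3) (1 : ℝ)))))
  have hcomp := continuous_det4_uncurried.continuousAt.comp hvec
  simpa only [Function.comp_def] using hcomp

/-- **Sign persistence**: if `χ` is continuous at `q₀`, `0 < d · χ q₀` and `0 < ε · d`, then `0 < ε · χ q` for all `q`
near `q₀`. [folklore] -/
theorem pos_near_of_continuousAt {χ : EuclideanSpace ℝ (Fin 3) → ℝ} {q₀ : EuclideanSpace ℝ (Fin 3)}
    (hcont : ContinuousAt χ q₀) {d ε : ℝ} (h0 : 0 < d * χ q₀) (hεd : 0 < ε * d) :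
    ∃ δ : ℝ, 0 < δ ∧ ∀ q : EuclideanSpace ℝ (Fin 3), dist q q₀ < δ → 0 < ε * χ q := by
  have hcont' : ContinuousAt (fun q => d * χ q) q₀ := continuousAt_const.mul hcont
  have hev : ∀ᶠ q in 𝓝 q₀, 0 < d * χ q := hcont'.eventually_const_lt h0
  obtain ⟨δ, hδ, hball⟩ := Metric.eventually_nhds_iff.1 hev
  refine ⟨δ, hδ, fun q hq => ?_⟩
  have h1 : 0 < d * χ q := hball hq
  have h2 : 0 < (ε * d) * (d * χ q) := mul_pos hεd h1
  have e : (ε * d) * (d * χ q) = (d * d) * (ε * χ q) := by ring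
  rw [e] at h2
  exact pos_of_mul_pos_right h2 (mul_self_nonneg d)

/-- **The character of the attaching-tube chart is continuous on the chart domain** `‖L q‖ < 1`.
[cite: Kosinski1993, VI §6] -/
theorem continuousAt_attachChar (q₀ : EuclideanSpace ℝ (Fin 3)) (hq₀ : ‖L q₀‖ < 1) :
    ContinuousAt (fun q : EuclideanSpace ℝ (Fin 3) =>
      det4 (gradient (rho g) ((((f.boundaryTube.toHomeo (circlePt (q 2), L q)).1).1 : EuclideanSpace ℝ (Fin 4))))
        (fderiv ℝ (fun q : EuclideanSpace ℝ (Fin 3) => (((f.boundaryTube.toHomeo (circlePt (q 2), L q)).1).1 :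
          EuclideanSpace ℝ (Fin 4))) q (EuclideanSpace.single (0 : Fin 3) (1 : ℝ)))
        (fderiv ℝ (fun q : EuclideanSpace ℝ (Fin 3) => (((f.boundaryTube.toHomeo (circlePt (q 2), L q)).1).1 :
          EuclideanSpace ℝ (Fin 4))) q (EuclideanSpace.single (1 : Fin 3) (1 : ℝ)))
        (fderiv ℝ (fun q : EuclideanSpace ℝ (Fin 3) => (((f.boundaryTube.toHomeo (circlePt (q 2), L q)).1).1 :
          EuclideanSpace ℝ (Fin 4))) q (EuclideanSpace.single (2 : Fin 3) (1 : ℝ)))) q₀ := by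
  have hU : IsOpen {q : EuclideanSpace ℝ (Fin 3) | ‖L q‖ < 1} :=
    isOpen_lt (continuous_norm.comp L.continuous) continuous_const
  have hFon : ContDiffOn ℝ ∞ (fun q : EuclideanSpace ℝ (Fin 3) => (((f.boundaryTube.toHomeo (circlePt (q 2), L q)).1).1 :
      EuclideanSpace ℝ (Fin 4))) {q : EuclideanSpace ℝ (Fin 3) | ‖L q‖ < 1} :=
    fun q hq => (contDiffAt_attachChart f q hq).contDiffWithinAt
  exact continuousAt_det4_char hU hFon hq₀

variable {c : ℂ} (hc : ‖c‖ = 1) (hKc : ∀ θ, f.attachingCircle θ ∈ page g c) {κ r : ℝ} (hκ : 0 < κ) (hr : 0 < r)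
  {Φ : CircleTube (bBase g).carrier} (hΦcore : ∀ ψ, (bBase g).incl (Φ.core ψ) = f.attachingCircle ψ)
  (hΦder : ∀ t : ℝ, HasFDerivAt (fun v : EuclideanSpace ℝ (Fin 2) =>
      ((bBase g).incl (Φ.toHomeo (circlePt t, v))).1)
    ((EuclideanSpace.proj (𝕜 := ℝ) (0 : Fin 2)).smulRight (r • cplxJ (deriv (ambCurve g f.attachingCircle) t)) +
      (EuclideanSpace.proj (𝕜 := ℝ) (1 : Fin 2)).smulRight (κ • rotField g (f.attachingCircle (circlePt t)).1)) 0)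
  {ε : ℝ} (hε : ∀ x, 0 < ε * CircleTube.frameSign f.boundaryTube Φ x)
  (hL : ∀ (p : EuclideanSpace ℝ (Fin 3)) (i : Fin 2), L p i = p (Fin.castSucc i))
include hc hKc hκ hr hΦcore hΦder hε hL

/-- **The character of the attaching-tube chart has the frame sign `ε` near the core**: for every angle `t`
there is `δ > 0` such that `0 < ε · det4 (∇rho (F q), ∂₀F, ∂₁F, ∂₂F) (q)` for all `q` within `δ` of the core
point `(0, 0, t)` (value at the core `…HgapCharTubeCore.lean` + continuity). [cite: Baykur2006, §2.3] -/
theorem attachChar_pos_near_core (t : ℝ) : ∃ δ : ℝ, 0 < δ ∧ ∀ q : EuclideanSpace ℝ (Fin 3),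
    dist q (EuclideanSpace.single (2 : Fin 3) t) < δ →
      0 < ε * det4 (gradient (rho g) ((((f.boundaryTube.toHomeo (circlePt (q 2), L q)).1).1 : EuclideanSpace ℝ (Fin 4))))
        (fderiv ℝ (fun q : EuclideanSpace ℝ (Fin 3) => (((f.boundaryTube.toHomeo (circlePt (q 2), L q)).1).1 :
          EuclideanSpace ℝ (Fin 4))) q (EuclideanSpace.single (0 : Fin 3) (1 : ℝ)))
        (fderiv ℝ (fun q : EuclideanSpace ℝ (Fin 3) => (((f.boundaryTube.toHomeo (circlePt (q 2), L q)).1).1 :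
          EuclideanSpace ℝ (Fin 4))) q (EuclideanSpace.single (1 : Fin 3) (1 : ℝ)))
        (fderiv ℝ (fun q : EuclideanSpace ℝ (Fin 3) => (((f.boundaryTube.toHomeo (circlePt (q 2), L q)).1).1 :
          EuclideanSpace ℝ (Fin 4))) q (EuclideanSpace.single (2 : Fin 3) (1 : ℝ))) := by
  have hcore : ∀ θ, f.boundaryTube.core θ = Φ.core θ := boundaryTube_core_eq_of_incl_core f hΦcore
  -- the value at the core has the sign of `det A`, and `ε det A > 0`
  obtain ⟨h0, h1, h2, h3⟩ := helper_attachChart_columns g f L hL t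
  have key := det4_fibreDeriv_core_pos f hc hKc hΦcore hΦder hκ hr t
  rw [← h0, ← h1, ← h2, ← h3] at key
  have hεd := fibreDeriv_det_sign hcore (circlePt t) (hε (circlePt t))
  -- continuity at the core point
  have hq₀L : ‖L (EuclideanSpace.single (2 : Fin 3) t)‖ < 1 := by rw [lam_single_two hL]; simp
  exact pos_near_of_continuousAt (continuousAt_attachChar f _ hq₀L) key hεd

end Near

/-! ## §2 `η♯ = F ∘ flip`; the flipped point -/

section FlipPoint

variable {L : EuclideanSpace ℝ (Fin 3) →L[ℝ] EuclideanSpace ℝ (Fin 2)}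

/-- The angle coordinate of the flipped point. [folklore] -/
theorem polarFlip_apply_two (p : EuclideanSpace ℝ (Fin 3)) :
    (!₂[‖L p‖ * Real.cos (2 * Real.pi * p 2), ‖L p‖ * Real.sin (2 * Real.pi * p 2),
      Complex.arg (toC (L p)) / (2 * Real.pi)] : EuclideanSpace ℝ (Fin 3)) 2 = Complex.arg (toC (L p)) / (2 * Real.pi) := by
  simp

variable (hL : ∀ (p : EuclideanSpace ℝ (Fin 3)) (i : Fin 2), L p i = p (Fin.castSucc i))
include hL

/-- **The fibre part of the flipped point is `‖m‖ e^{2πiφ}`.** [folklore] -/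
theorem lam_polarFlip (p : EuclideanSpace ℝ (Fin 3)) :
    L (!₂[‖L p‖ * Real.cos (2 * Real.pi * p 2), ‖L p‖ * Real.sin (2 * Real.pi * p 2),
      Complex.arg (toC (L p)) / (2 * Real.pi)] : EuclideanSpace ℝ (Fin 3)) =
      ‖L p‖ • ((circlePt (p 2) : sphere (0 : EuclideanSpace ℝ (Fin 2)) 1) : EuclideanSpace ℝ (Fin 2)) := by
  ext i; rw [hL]; fin_cases i <;> simp

/-- The flipped point stays in the chart domain: `‖L (flip p)‖ = ‖L p‖`. [folklore] -/
theorem norm_lam_polarFlip (p : EuclideanSpace ℝ (Fin 3)) :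
    ‖L (!₂[‖L p‖ * Real.cos (2 * Real.pi * p 2), ‖L p‖ * Real.sin (2 * Real.pi * p 2),
      Complex.arg (toC (L p)) / (2 * Real.pi)] : EuclideanSpace ℝ (Fin 3))‖ = ‖L p‖ := by
  rw [lam_polarFlip hL, norm_smul, norm_eq_of_mem_sphere, mul_one, norm_norm]

omit hL in
/-- **The flipped point is at distance `‖L p‖` from the core point `(0, 0, arg (toC (L p)) / 2π)`.** [folklore] -/
theorem dist_polarFlip_single (p : EuclideanSpace ℝ (Fin 3)) :
    dist (!₂[‖L p‖ * Real.cos (2 * Real.pi * p 2), ‖L p‖ * Real.sin (2 * Real.pi * p 2),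
        Complex.arg (toC (L p)) / (2 * Real.pi)] : EuclideanSpace ℝ (Fin 3))
      (EuclideanSpace.single (2 : Fin 3) (Complex.arg (toC (L p)) / (2 * Real.pi))) = ‖L p‖ := by
  rw [EuclideanSpace.dist_eq, Fin.sum_univ_three]
  simp only [Matrix.cons_val_zero, Matrix.cons_val_one, Matrix.cons_val, PiLp.single_apply,
    Real.dist_eq, sq_abs]
  have e : (‖L p‖ * Real.cos (2 * Real.pi * p 2) - 0) ^ 2 + (‖L p‖ * Real.sin (2 * Real.pi * p 2) - 0) ^ 2 +
      (Complex.arg (toC (L p)) / (2 * Real.pi) - Complex.arg (toC (L p)) / (2 * Real.pi)) ^ 2 = ‖L p‖ ^ 2 := by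
    nlinarith [Real.cos_sq_add_sin_sq (2 * Real.pi * p 2)]
  simp only [Fin.isValue, if_true, show ((0 : Fin 3) = 2) = False by decide,
    show ((1 : Fin 3) = 2) = False by decide, if_false] at e ⊢
  rw [e, Real.sqrt_sq (norm_nonneg _)]

/-- **`η♯ = F ∘ flip` at a point**: the attaching-tube chart at the flipped point is H1's tube-side map.
[cite: Kosinski1993, VI §6 (6.1)] -/
theorem attachChart_polarFlip (f : HandleAttachingMap 3 2 (Base g)) (p : EuclideanSpace ℝ (Fin 3)) :
    ((((f.boundaryTube.toHomeo (circlePt ((!₂[‖L p‖ * Real.cos (2 * Real.pi * p 2), ‖L p‖ * Real.sin (2 * Real.pi * p 2),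
        Complex.arg (toC (L p)) / (2 * Real.pi)] : EuclideanSpace ℝ (Fin 3)) 2),
        L (!₂[‖L p‖ * Real.cos (2 * Real.pi * p 2), ‖L p‖ * Real.sin (2 * Real.pi * p 2),
          Complex.arg (toC (L p)) / (2 * Real.pi)] : EuclideanSpace ℝ (Fin 3)))).1).1 : EuclideanSpace ℝ (Fin 4))) =
      ((f.boundaryTube.toHomeo (circlePt (Complex.arg (toC (L p)) / (2 * Real.pi)),
        ‖L p‖ • ((circlePt (p 2) : sphere (0 : EuclideanSpace ℝ (Fin 2)) 1) : EuclideanSpace ℝ (Fin 2)))).1).1 := by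
  rw [polarFlip_apply_two, lam_polarFlip hL]

/-- **`η♯ = F ∘ flip` as maps `ℝ³ → ℝ⁴`.** [cite: Kosinski1993, VI §6 (6.1)] -/
theorem tubeChart_eq_comp_polarFlip (f : HandleAttachingMap 3 2 (Base g)) :
    (fun p : EuclideanSpace ℝ (Fin 3) => ((((f.boundaryTube.toHomeo (circlePt (Complex.arg (toC (L p)) / (2 * Real.pi)),
        ‖L p‖ • ((circlePt (p 2) : Metric.sphere (0 : EuclideanSpace ℝ (Fin 2)) 1) : EuclideanSpace ℝ (Fin 2)))).1).1 :
          EuclideanSpace ℝ (Fin 4)))) =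
      fun p' : EuclideanSpace ℝ (Fin 3) =>
        (((f.boundaryTube.toHomeo (circlePt ((!₂[‖L p'‖ * Real.cos (2 * Real.pi * p' 2),
          ‖L p'‖ * Real.sin (2 * Real.pi * p' 2), Complex.arg (toC (L p')) / (2 * Real.pi)] : EuclideanSpace ℝ (Fin 3)) 2),
          L (!₂[‖L p'‖ * Real.cos (2 * Real.pi * p' 2), ‖L p'‖ * Real.sin (2 * Real.pi * p' 2),
            Complex.arg (toC (L p')) / (2 * Real.pi)] : EuclideanSpace ℝ (Fin 3)))).1).1 : EuclideanSpace ℝ (Fin 4)) := by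
  funext p
  exact (attachChart_polarFlip hL f p).symm

end FlipPoint

/-! ## §3 The orientation character of the tube-side map is `-ε` -/

section Tube

variable (f : HandleAttachingMap 3 2 (Base g)) {L : EuclideanSpace ℝ (Fin 3) →L[ℝ] EuclideanSpace ℝ (Fin 2)}
  {c : ℂ} (hc : ‖c‖ = 1) (hKc : ∀ θ, f.attachingCircle θ ∈ page g c) {κ r : ℝ} (hκ : 0 < κ) (hr : 0 < r)
  {Φ : CircleTube (bBase g).carrier} (hΦcore : ∀ ψ, (bBase g).incl (Φ.core ψ) = f.attachingCircle ψ)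
  (hΦder : ∀ t : ℝ, HasFDerivAt (fun v : EuclideanSpace ℝ (Fin 2) =>
      ((bBase g).incl (Φ.toHomeo (circlePt t, v))).1)
    ((EuclideanSpace.proj (𝕜 := ℝ) (0 : Fin 2)).smulRight (r • cplxJ (deriv (ambCurve g f.attachingCircle) t)) +
      (EuclideanSpace.proj (𝕜 := ℝ) (1 : Fin 2)).smulRight (κ • rotField g (f.attachingCircle (circlePt t)).1)) 0)
  {ε : ℝ} (hε : ∀ x, 0 < ε * CircleTube.frameSign f.boundaryTube Φ x)
  (hL : ∀ (p : EuclideanSpace ℝ (Fin 3)) (i : Fin 2), L p i = p (Fin.castSucc i))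
include hc hKc hκ hr hΦcore hΦder hε hL

omit hc hKc hκ hr hΦcore hΦder hε hL in
/-- `toC` commutes with real scaling. [folklore] -/
theorem toC_real_smul (ρ : ℝ) (u : EuclideanSpace ℝ (Fin 2)) : toC (ρ • u) = (ρ : ℂ) * toC u := by
  apply Complex.ext <;> simp [toC]

omit hc hKc hκ hr hΦcore hΦder hε in
/-- **`χ_η (p) = -χ_F (flip p)`**: the character of H1's tube-side map at a glued point `p` (fibre part off the
closed negative real axis, `‖L p‖ < 1`) is minus the character of the attaching-tube chart at the flipped point
(`η♯ = F ∘ flip`, `det D(flip) = -1`). [cite: Kosinski1993, VI §6 (6.1)] -/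
theorem tubeChar_eq_neg_attachChar {p : EuclideanSpace ℝ (Fin 3)} (hm : toC (L p) ∈ slitPlane) (hp1 : ‖L p‖ < 1) :
    det4 (gradient (rho g) (((f.boundaryTube.toHomeo (circlePt (Complex.arg (toC (L p)) / (2 * Real.pi)),
          ‖L p‖ • ((circlePt (p 2) : Metric.sphere (0 : EuclideanSpace ℝ (Fin 2)) 1) : EuclideanSpace ℝ (Fin 2)))).1).1 : EuclideanSpace ℝ (Fin 4)))
        (mfderiv 𝓘(ℝ, EuclideanSpace ℝ (Fin 3)) 𝓘(ℝ, EuclideanSpace ℝ (Fin 4))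
          (fun p : EuclideanSpace ℝ (Fin 3) => ((((f.boundaryTube.toHomeo (circlePt (Complex.arg (toC (L p)) / (2 * Real.pi)),
            ‖L p‖ • ((circlePt (p 2) : Metric.sphere (0 : EuclideanSpace ℝ (Fin 2)) 1) : EuclideanSpace ℝ (Fin 2)))).1).1 :
              EuclideanSpace ℝ (Fin 4)))) p (EuclideanSpace.single (0 : Fin 3) (1 : ℝ)))
        (mfderiv 𝓘(ℝ, EuclideanSpace ℝ (Fin 3)) 𝓘(ℝ, EuclideanSpace ℝ (Fin 4))
          (fun p : EuclideanSpace ℝ (Fin 3) => ((((f.boundaryTube.toHomeo (circlePt (Complex.arg (toC (L p)) / (2 * Real.pi)),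
            ‖L p‖ • ((circlePt (p 2) : Metric.sphere (0 : EuclideanSpace ℝ (Fin 2)) 1) : EuclideanSpace ℝ (Fin 2)))).1).1 :
              EuclideanSpace ℝ (Fin 4)))) p (EuclideanSpace.single (1 : Fin 3) (1 : ℝ)))
        (mfderiv 𝓘(ℝ, EuclideanSpace ℝ (Fin 3)) 𝓘(ℝ, EuclideanSpace ℝ (Fin 4))
          (fun p : EuclideanSpace ℝ (Fin 3) => ((((f.boundaryTube.toHomeo (circlePt (Complex.arg (toC (L p)) / (2 * Real.pi)),
            ‖L p‖ • ((circlePt (p 2) : Metric.sphere (0 : EuclideanSpace ℝ (Fin 2)) 1) : EuclideanSpace ℝ (Fin 2)))).1).1 :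
              EuclideanSpace ℝ (Fin 4)))) p (EuclideanSpace.single (2 : Fin 3) (1 : ℝ))) =
      - det4 (gradient (rho g) (((f.boundaryTube.toHomeo (circlePt (Complex.arg (toC (L p)) / (2 * Real.pi)),
          ‖L p‖ • ((circlePt (p 2) : Metric.sphere (0 : EuclideanSpace ℝ (Fin 2)) 1) : EuclideanSpace ℝ (Fin 2)))).1).1 : EuclideanSpace ℝ (Fin 4)))
        (fderiv ℝ (fun q : EuclideanSpace ℝ (Fin 3) =>
            (((f.boundaryTube.toHomeo (circlePt (q 2), L q)).1).1 : EuclideanSpace ℝ (Fin 4)))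
          (!₂[‖L p‖ * Real.cos (2 * Real.pi * p 2), ‖L p‖ * Real.sin (2 * Real.pi * p 2),
            Complex.arg (toC (L p)) / (2 * Real.pi)] : EuclideanSpace ℝ (Fin 3)) (EuclideanSpace.single (0 : Fin 3) (1 : ℝ)))
        (fderiv ℝ (fun q : EuclideanSpace ℝ (Fin 3) =>
            (((f.boundaryTube.toHomeo (circlePt (q 2), L q)).1).1 : EuclideanSpace ℝ (Fin 4)))
          (!₂[‖L p‖ * Real.cos (2 * Real.pi * p 2), ‖L p‖ * Real.sin (2 * Real.pi * p 2),
            Complex.arg (toC (L p)) / (2 * Real.pi)] : EuclideanSpace ℝ (Fin 3)) (EuclideanSpace.single (1 : Fin 3) (1 : ℝ)))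
        (fderiv ℝ (fun q : EuclideanSpace ℝ (Fin 3) =>
            (((f.boundaryTube.toHomeo (circlePt (q 2), L q)).1).1 : EuclideanSpace ℝ (Fin 4)))
          (!₂[‖L p‖ * Real.cos (2 * Real.pi * p 2), ‖L p‖ * Real.sin (2 * Real.pi * p 2),
            Complex.arg (toC (L p)) / (2 * Real.pi)] : EuclideanSpace ℝ (Fin 3)) (EuclideanSpace.single (2 : Fin 3) (1 : ℝ))) := by
  have hLq : ‖L (!₂[‖L p‖ * Real.cos (2 * Real.pi * p 2), ‖L p‖ * Real.sin (2 * Real.pi * p 2),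
            Complex.arg (toC (L p)) / (2 * Real.pi)] : EuclideanSpace ℝ (Fin 3))‖ < 1 := by
    rw [norm_lam_polarFlip hL]; exact hp1
  have hFd : DifferentiableAt ℝ (fun q : EuclideanSpace ℝ (Fin 3) =>
            (((f.boundaryTube.toHomeo (circlePt (q 2), L q)).1).1 : EuclideanSpace ℝ (Fin 4)))
      (!₂[‖L p‖ * Real.cos (2 * Real.pi * p 2), ‖L p‖ * Real.sin (2 * Real.pi * p 2),
            Complex.arg (toC (L p)) / (2 * Real.pi)] : EuclideanSpace ℝ (Fin 3)) :=
    (contDiffAt_attachChart f _ hLq).differentiableAt (by simp)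
  simp only [mfderiv_eq_fderiv]
  rw [tubeChart_eq_comp_polarFlip hL f]
  exact det4_fderiv_comp_polarFlip hL hm hFd _

/-- **(R6c) The orientation character of the tube-side map is `-ε` near the core, in every direction off the
closed negative real axis.**  For a unit vector `u` with `toC u ∈ slitPlane` there is `δ > 0` such that for all
`p` with fibre part `L p = ρ u`, `0 < ρ < δ`:
`0 < -ε · det4 (∇rho (η♯ p), ∂₀η♯ (p), ∂₁η♯ (p), ∂₂η♯ (p))`, `η♯` H1's tube-side map (core angle `dir (L p)`,
fibre vector `‖L p‖ e^{2πi p₂}` of the attaching tube): `η♯ = F ∘ flip`, `det D(flip) = -1`, and the character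
of `F` near the core point `(0, 0, arg (toC u) / 2π)` is `ε`. [cite: Baykur2006, §2.3] -/
theorem tubeChar_neg_frameSign (u : EuclideanSpace ℝ (Fin 2)) (hu : ‖u‖ = 1) (hus : toC u ∈ slitPlane) :
    ∃ δ : ℝ, 0 < δ ∧ ∀ (p : EuclideanSpace ℝ (Fin 3)) (ρ : ℝ), 0 < ρ → ρ < δ → L p = ρ • u →
      0 < -ε * det4 (gradient (rho g) ((((f.boundaryTube.toHomeo (circlePt (Complex.arg (toC (L p)) / (2 * Real.pi)),
          ‖L p‖ • ((circlePt (p 2) : Metric.sphere (0 : EuclideanSpace ℝ (Fin 2)) 1) : EuclideanSpace ℝ (Fin 2)))).1).1 :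
            EuclideanSpace ℝ (Fin 4))))
        (mfderiv 𝓘(ℝ, EuclideanSpace ℝ (Fin 3)) 𝓘(ℝ, EuclideanSpace ℝ (Fin 4))
          (fun p : EuclideanSpace ℝ (Fin 3) => ((((f.boundaryTube.toHomeo (circlePt (Complex.arg (toC (L p)) / (2 * Real.pi)),
            ‖L p‖ • ((circlePt (p 2) : Metric.sphere (0 : EuclideanSpace ℝ (Fin 2)) 1) : EuclideanSpace ℝ (Fin 2)))).1).1 :
              EuclideanSpace ℝ (Fin 4)))) p (EuclideanSpace.single (0 : Fin 3) (1 : ℝ)))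
        (mfderiv 𝓘(ℝ, EuclideanSpace ℝ (Fin 3)) 𝓘(ℝ, EuclideanSpace ℝ (Fin 4))
          (fun p : EuclideanSpace ℝ (Fin 3) => ((((f.boundaryTube.toHomeo (circlePt (Complex.arg (toC (L p)) / (2 * Real.pi)),
            ‖L p‖ • ((circlePt (p 2) : Metric.sphere (0 : EuclideanSpace ℝ (Fin 2)) 1) : EuclideanSpace ℝ (Fin 2)))).1).1 :
              EuclideanSpace ℝ (Fin 4)))) p (EuclideanSpace.single (1 : Fin 3) (1 : ℝ)))
        (mfderiv 𝓘(ℝ, EuclideanSpace ℝ (Fin 3)) 𝓘(ℝ, EuclideanSpace ℝ (Fin 4))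
          (fun p : EuclideanSpace ℝ (Fin 3) => ((((f.boundaryTube.toHomeo (circlePt (Complex.arg (toC (L p)) / (2 * Real.pi)),
            ‖L p‖ • ((circlePt (p 2) : Metric.sphere (0 : EuclideanSpace ℝ (Fin 2)) 1) : EuclideanSpace ℝ (Fin 2)))).1).1 :
              EuclideanSpace ℝ (Fin 4)))) p (EuclideanSpace.single (2 : Fin 3) (1 : ℝ))) := by
  obtain ⟨δ₁, hδ₁, hnear⟩ := attachChar_pos_near_core f hc hKc hκ hr hΦcore hΦder hε hL (Complex.arg (toC u) / (2 * Real.pi))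
  refine ⟨min δ₁ 1, lt_min hδ₁ one_pos, fun p ρ hρ hρδ hLp => ?_⟩
  have hρδ₁ : ρ < δ₁ := lt_of_lt_of_le hρδ (min_le_left _ _)
  have hρ1 : ρ < 1 := lt_of_lt_of_le hρδ (min_le_right _ _)
  have hnp : ‖L p‖ = ρ := by rw [hLp, norm_smul, Real.norm_eq_abs, abs_of_pos hρ, hu, mul_one]
  have harg : Complex.arg (toC (L p)) = Complex.arg (toC u) := by
    rw [hLp, toC_real_smul]; exact Complex.arg_real_mul (toC u) hρ
  have hm : toC (L p) ∈ slitPlane := by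
    rw [hLp, toC_real_smul, Complex.mem_slitPlane_iff, Complex.re_ofReal_mul, Complex.im_ofReal_mul]
    rcases Complex.mem_slitPlane_iff.1 hus with h | h
    · exact Or.inl (mul_pos hρ h)
    · exact Or.inr (mul_ne_zero hρ.ne' h)
  -- the flipped point: at distance `ρ < δ₁` from the core point
  have hdist : dist (!₂[‖L p‖ * Real.cos (2 * Real.pi * p 2), ‖L p‖ * Real.sin (2 * Real.pi * p 2),
      Complex.arg (toC (L p)) / (2 * Real.pi)] : EuclideanSpace ℝ (Fin 3))
      (EuclideanSpace.single (2 : Fin 3) (Complex.arg (toC u) / (2 * Real.pi))) < δ₁ := by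
    rw [← harg, dist_polarFlip_single, hnp]; exact hρδ₁
  have hpos := hnear _ hdist
  rw [attachChart_polarFlip hL f p] at hpos
  -- `χ_η (p) = -χ_F (flip p)`
  have hp1 : ‖L p‖ < 1 := by rw [hnp]; exact hρ1
  rw [tubeChar_eq_neg_attachChar f hL hm hp1]
  nlinarith [hpos]

omit hc hKc hκ hr hΦcore hΦder hε hL in
/-- `e₀` is a unit vector of `ℝ²`. [folklore] -/
theorem norm_planeE0_eq_one : ‖(planeE0 : EuclideanSpace ℝ (Fin 2))‖ = 1 := by
  rw [planeE0, PiLp.norm_single, norm_one]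

omit hc hKc hκ hr hΦcore hΦder hε hL in
/-- `toC e₀ = 1`. [folklore] -/
theorem toC_planeE0 : toC planeE0 = 1 := by
  apply Complex.ext <;> simp [toC]

/-- **(R6c) along the positive `e₀`-ray** (the form consumed by H3's assembly, matching H1's rider
`L p = ‖L p‖ • planeE0`): there is `δ > 0` with `0 < -ε · χ_η (p)` for all `p` with `L p = ‖L p‖ • e₀`,
`0 < ‖L p‖ < δ`. [cite: Baykur2006, §2.3] -/
theorem tubeChar_neg_frameSign_ray : ∃ δ : ℝ, 0 < δ ∧ ∀ p : EuclideanSpace ℝ (Fin 3), 0 < ‖L p‖ → ‖L p‖ < δ →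
    L p = ‖L p‖ • planeE0 →
      0 < -ε * det4 (gradient (rho g) ((((f.boundaryTube.toHomeo (circlePt (Complex.arg (toC (L p)) / (2 * Real.pi)),
          ‖L p‖ • ((circlePt (p 2) : Metric.sphere (0 : EuclideanSpace ℝ (Fin 2)) 1) : EuclideanSpace ℝ (Fin 2)))).1).1 :
            EuclideanSpace ℝ (Fin 4))))
        (mfderiv 𝓘(ℝ, EuclideanSpace ℝ (Fin 3)) 𝓘(ℝ, EuclideanSpace ℝ (Fin 4))
          (fun p : EuclideanSpace ℝ (Fin 3) => ((((f.boundaryTube.toHomeo (circlePt (Complex.arg (toC (L p)) / (2 * Real.pi)),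
            ‖L p‖ • ((circlePt (p 2) : Metric.sphere (0 : EuclideanSpace ℝ (Fin 2)) 1) : EuclideanSpace ℝ (Fin 2)))).1).1 :
              EuclideanSpace ℝ (Fin 4)))) p (EuclideanSpace.single (0 : Fin 3) (1 : ℝ)))
        (mfderiv 𝓘(ℝ, EuclideanSpace ℝ (Fin 3)) 𝓘(ℝ, EuclideanSpace ℝ (Fin 4))
          (fun p : EuclideanSpace ℝ (Fin 3) => ((((f.boundaryTube.toHomeo (circlePt (Complex.arg (toC (L p)) / (2 * Real.pi)),
            ‖L p‖ • ((circlePt (p 2) : Metric.sphere (0 : EuclideanSpace ℝ (Fin 2)) 1) : EuclideanSpace ℝ (Fin 2)))).1).1 :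
              EuclideanSpace ℝ (Fin 4)))) p (EuclideanSpace.single (1 : Fin 3) (1 : ℝ)))
        (mfderiv 𝓘(ℝ, EuclideanSpace ℝ (Fin 3)) 𝓘(ℝ, EuclideanSpace ℝ (Fin 4))
          (fun p : EuclideanSpace ℝ (Fin 3) => ((((f.boundaryTube.toHomeo (circlePt (Complex.arg (toC (L p)) / (2 * Real.pi)),
            ‖L p‖ • ((circlePt (p 2) : Metric.sphere (0 : EuclideanSpace ℝ (Fin 2)) 1) : EuclideanSpace ℝ (Fin 2)))).1).1 :
              EuclideanSpace ℝ (Fin 4)))) p (EuclideanSpace.single (2 : Fin 3) (1 : ℝ))) := by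
  obtain ⟨δ, hδ, h⟩ := tubeChar_neg_frameSign f hc hKc hκ hr hΦcore hΦder hε hL planeE0 norm_planeE0_eq_one
    (by rw [toC_planeE0, ← Complex.ofReal_one]; exact Complex.ofReal_mem_slitPlane.2 one_pos)
  exact ⟨δ, hδ, fun p hp hpδ hray => h p ‖L p‖ hp hpδ hray⟩

end Tube

/-! ## §4 The registered package -/

/-- **Sub-goal `helper_beltChar_tube` of stub `stub_T3_dualPresentation`** (T3 ▸ HB = `helper_Hgap_twisting` ▸
transfer step (R6c), tube side; wave 7, lead c5, worker H2): **the orientation character of the tube-side map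
`η̂ = f♭ ∘ flip` is `-ε`** — for an attaching map `f` with attaching circle in the flat page of direction `c`, Z4's
page tube `Φ` (clauses `hΦcore`, `hΦder`, `0 < κ`, `0 < r`), a sign `ε` of the orientation function of the
transition `Φ⁻¹ ∘ f♭` (`0 < ε · frameSign f♭ Φ x`) and the fibre part `L`, there is `δ > 0` such that at every
point `p` of the positive `e₀`-ray (`L p = ‖L p‖ • e₀`, `0 < ‖L p‖ < δ`) H1's tube-side character satisfies
`0 < -ε · det4 (∇rho (η♯ p), ∂₀η♯, ∂₁η♯, ∂₂η♯)`.  (General directions: `tubeChar_neg_frameSign`.) [cite: Baykur2006, §2.3] -/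
theorem helper_beltChar_tube : ∀ (g : ℕ) (f : Literature.Topology.FourManifolds.HandleAttachingMap 3 2 (Literature.Topology.FourManifolds.LefschetzBase.Base g)) (c : ℂ), ‖c‖ = 1 → (∀ θ, f.attachingCircle θ ∈ Literature.Topology.FourManifolds.LefschetzBase.page g c) → ∀ (κ r : ℝ) (Φ : Literature.Topology.FourManifolds.CircleTube (Literature.Topology.FourManifolds.LefschetzBase.bBase g).carrier), 0 < κ → 0 < r → (∀ ψ, (Literature.Topology.FourManifolds.LefschetzBase.bBase g).incl (Φ.core ψ) = f.attachingCircle ψ) → (∀ t : ℝ, HasFDerivAt (fun v : EuclideanSpace ℝ (Fin 2) => ((Literature.Topology.FourManifolds.LefschetzBase.bBase g).incl (Φ.toHomeo (Literature.Topology.FourManifolds.circlePt t, v))).1) ((EuclideanSpace.proj (𝕜 := ℝ) (0 : Fin 2)).smulRight (r • Literature.Topology.FourManifolds.LefschetzBase.cplxJ (deriv (Literature.Topology.FourManifolds.LefschetzBase.ambCurve g f.attachingCircle) t)) + (EuclideanSpace.proj (𝕜 := ℝ) (1 : Fin 2)).smulRight (κ • Summit.SmoothPoincare4.SmoothPoincare4.Theorems.AcyclicBisectionExists.ModpBraidOrbits.rotField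 g (f.attachingCircle (Literature.Topology.FourManifolds.circlePt t)).1)) 0) → ∀ (ε : ℝ), (∀ x, 0 < ε * Literature.Topology.FourManifolds.CircleTube.frameSign f.boundaryTube Φ x) → ∀ (L : EuclideanSpace ℝ (Fin 3) →L[ℝ] EuclideanSpace ℝ (Fin 2)), (∀ (p : EuclideanSpace ℝ (Fin 3)) (i : Fin 2), L p i = p (Fin.castSucc i)) → ∃ δ : ℝ, 0 < δ ∧ ∀ p : EuclideanSpace ℝ (Fin 3), 0 < ‖L p‖ → ‖L p‖ < δ → L p = ‖L p‖ • Literature.Topology.FourManifolds.planeE0 → 0 < -ε * Literature.Geometry.Symplectic.det4 (gradient (Literature.Topology.FourManifolds.LefschetzBase.rho g) (((f.boundaryTube.toHomeo (Literature.Topology.FourManifolds.circlePt (Complex.arg (Literature.Topology.FourManifolds.toC (L p)) / (2 * Real.pi)), ‖L p‖ • ((Literature.Topology.FourManifolds.circlePt (p 2) : Metric.sphere (0 : EuclideanSpace ℝ (Fin 2)) 1) : EuclideanSpace ℝ (Fin 2)))).1).1 : EuclideanSpace ℝ (Fin 4))) (mfderiv 𝓘(ℝ, EuclideanSpace ℝ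 (Fin 3)) 𝓘(ℝ, EuclideanSpace ℝ (Fin 4)) (fun p : EuclideanSpace ℝ (Fin 3) => ((((f.boundaryTube.toHomeo (Literature.Topology.FourManifolds.circlePt (Complex.arg (Literature.Topology.FourManifolds.toC (L p)) / (2 * Real.pi)), ‖L p‖ • ((Literature.Topology.FourManifolds.circlePt (p 2) : Metric.sphere (0 : EuclideanSpace ℝ (Fin 2)) 1) : EuclideanSpace ℝ (Fin 2)))).1).1 : EuclideanSpace ℝ (Fin 4)))) p (EuclideanSpace.single (0 : Fin 3) (1 : ℝ))) (mfderiv 𝓘(ℝ, EuclideanSpace ℝ (Fin 3)) 𝓘(ℝ, EuclideanSpace ℝ (Fin 4)) (fun p : EuclideanSpace ℝ (Fin 3) => ((((f.boundaryTube.toHomeo (Literature.Topology.FourManifolds.circlePt (Complex.arg (Literature.Topology.FourManifolds.toC (L p)) / (2 * Real.pi)), ‖L p‖ • ((Literature.Topology.FourManifolds.circlePt (p 2) : Metric.sphere (0 : EuclideanSpace ℝ (Fin 2)) 1) : EuclideanSpace ℝ (Fin 2)))).1).1 : EuclideanSpace ℝ (Fin 4)))) p (EuclideanSpace.single (1 :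 Fin 3) (1 : ℝ))) (mfderiv 𝓘(ℝ, EuclideanSpace ℝ (Fin 3)) 𝓘(ℝ, EuclideanSpace ℝ (Fin 4)) (fun p : EuclideanSpace ℝ (Fin 3) => ((((f.boundaryTube.toHomeo (Literature.Topology.FourManifolds.circlePt (Complex.arg (Literature.Topology.FourManifolds.toC (L p)) / (2 * Real.pi)), ‖L p‖ • ((Literature.Topology.FourManifolds.circlePt (p 2) : Metric.sphere (0 : EuclideanSpace ℝ (Fin 2)) 1) : EuclideanSpace ℝ (Fin 2)))).1).1 : EuclideanSpace ℝ (Fin 4)))) p (EuclideanSpace.single (2 : Fin 3) (1 : ℝ))) :=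
  fun _ f _ hc hKc _ _ _ hκ hr hΦcore hΦder _ hε _ hL =>
    tubeChar_neg_frameSign_ray f hc hKc hκ hr hΦcore hΦder hε hL


end Summit.SmoothPoincare4.SmoothPoincare4.Theorems.AcyclicBisectionExists.ModpBraidOrbits

end
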